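import Mathlib
import Summits.ValiantsHypothesis.ValiantsHypothesis.Theorems.ZeroOneTransfer.Negative.TopComponentFree
import Literature.Computability.AlgebraicComplexity.ArithCircuitProofs

/-!
# Crux `DivisionGap.PerDivisionHard` (stmt-ValiantsHypothesis-5065), line
`pair-descent-jss-endpoint` — stub `stub_liveStructure`: the live structure lemma

In a straight-line circuit `P` over the semiring `ℝ≥0` there is no cancellation: the support of
a product is the sumset of the supports (`JerrumSnir.support_mul_eq`) and the support of a
positive combination is the union (`JerrumSnir.mem_support_list_sum`, `support_smul_eq`), and the
same holds for top-`w` components (`topComponent_list_prod`, `topComponent_list_sum`).  Hence,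
if the top-`w` component of `P.eval` has two distinct monomials, walking DOWN from the output one
reaches a SUM gate `i` with two effective operands (nonzero coefficient, nonzero value of top
weighted degree — exactly the operands kept by `topComponent_list_sum`) whose top components are
single monomials `a₁ ≠ a₂`; the cofactor `b` accumulated along the walk (one monomial of the top
of every other factor at a product gate, nothing at a sum gate) witnesses LIVENESS:
`a₁ + b, a₂ + b ∈ supp (top_w P.eval)`.

The walk is a strong induction on the gate index (`exists_liveTie_of_gateVal`), phrased with the
`JerrumSnir.gateVal / opVal` reading of the fold semantics `ArithCircuit.gateValues`
(`Literature/Barriers/ValiantsHypothesis/MonotoneGapParseTrees.lean`). [folklore]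
-/

noncomputable section

-- `Summit.ValiantsHypothesis.ValiantsHypothesis.…` is the tree's mandated single-conjunct layout
-- (Sub = Summit), so the duplicated namespace component is intended.
set_option linter.dupNamespace false

namespace Summit.ValiantsHypothesis.ValiantsHypothesis.Theorems.DivisionGapPerDivisionHard

open MvPolynomial Literature.Computability.AlgebraicComplexity
open Literature.Barriers.ValiantsHypothesis
open Summit.ValiantsHypothesis.ValiantsHypothesis.Theorems.ZeroOneTransfer.Negative
open ArithCircuit (Gate Operand gateValues)
open scoped NNReal Pointwise

variable {σ : Type*} [DecidableEq σ] (w : σ → ℕ)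

/-! ### Supports of list products over `ℝ≥0` -/

/-- Over `ℝ≥0`: if a list product has two distinct monomials, some factor has two distinct
monomials, and a translate of the whole support of that factor lies in the support of the
product (supports of products are sumsets, `JerrumSnir.support_mul_eq`). [folklore] -/
theorem exists_factor_of_mem_support_prod (l : List (MvPolynomial σ ℝ≥0)) :
    ∀ {m₁ m₂ : σ →₀ ℕ}, m₁ ∈ l.prod.support → m₂ ∈ l.prod.support → m₁ ≠ m₂ →
      ∃ p ∈ l, ∃ (c x₁ x₂ : σ →₀ ℕ), x₁ ∈ p.support ∧ x₂ ∈ p.support ∧ x₁ ≠ x₂ ∧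
        ∀ x ∈ p.support, x + c ∈ l.prod.support := by
  induction l with
  | nil =>
    intro m₁ m₂ h₁ h₂ hne
    rw [List.prod_nil, ← C_1, C_apply] at h₁ h₂
    exact absurd ((Finset.mem_singleton.mp (support_monomial_subset h₁)).trans
      (Finset.mem_singleton.mp (support_monomial_subset h₂)).symm) hne
  | cons p l ih =>
    intro m₁ m₂ h₁ h₂ hne
    rw [List.prod_cons, JerrumSnir.support_mul_eq] at h₁ h₂
    obtain ⟨x₁, hx₁, y₁, hy₁, rfl⟩ := Finset.mem_add.1 h₁
    obtain ⟨x₂, hx₂, y₂, hy₂, rfl⟩ := Finset.mem_add.1 h₂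
    by_cases hx : x₁ = x₂
    · subst hx
      have hy : y₁ ≠ y₂ := fun h => hne (by rw [h])
      obtain ⟨q, hq, c, z₁, z₂, hz₁, hz₂, hzne, hall⟩ := ih hy₁ hy₂ hy
      refine ⟨q, List.mem_cons_of_mem _ hq, c + x₁, z₁, z₂, hz₁, hz₂, hzne, fun x hx' => ?_⟩
      rw [List.prod_cons, JerrumSnir.support_mul_eq, ← add_assoc, add_comm (x + c)]
      exact Finset.add_mem_add hx₁ (hall x hx')
    · refine ⟨p, List.mem_cons_self, y₁, x₁, x₂, hx₁, hx₂, hx, fun x hx' => ?_⟩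
      rw [List.prod_cons, JerrumSnir.support_mul_eq]
      exact Finset.add_mem_add hx' hy₁

/-! ### Reading the circuit: operands and sum gates -/

omit [DecidableEq σ] in
/-- An operand whose value (read at gate `j`) has two distinct monomials in its top component is
a reference to an EARLIER gate `j' < j`, and its value is the value of that gate (variables and
constants have one-monomial tops, junk references evaluate to `0`). [folklore] -/
theorem exists_lt_opVal_eq_gateVal {gs : List (Gate ℝ≥0 σ)} {j : ℕ} {u : Operand ℝ≥0 σ}
    {m₁ m₂ : σ →₀ ℕ} (h₁ : m₁ ∈ (topComponent w (JerrumSnir.opVal gs j u)).support)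
    (h₂ : m₂ ∈ (topComponent w (JerrumSnir.opVal gs j u)).support) (hne : m₁ ≠ m₂) :
    ∃ j' < j, JerrumSnir.opVal gs j u = JerrumSnir.gateVal gs j' := by
  cases u with
  | var i =>
    rw [JerrumSnir.opVal_var, topComponent_X, support_X, Finset.mem_singleton] at h₁ h₂
    exact absurd (h₁.trans h₂.symm) hne
  | const c =>
    rw [JerrumSnir.opVal_const, topComponent_C, C_apply] at h₁ h₂
    exact absurd ((Finset.mem_singleton.mp (support_monomial_subset h₁)).trans
      (Finset.mem_singleton.mp (support_monomial_subset h₂)).symm) hne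
  | gate j' =>
    by_cases hj : j' < j
    · exact ⟨j', hj, by rw [JerrumSnir.opVal_gate, if_pos hj]⟩
    · rw [JerrumSnir.opVal_gate, if_neg hj, topComponent_zero, support_zero] at h₁
      exact absurd h₁ (Finset.notMem_empty _)

/-- At a SUM gate over `ℝ≥0`, every monomial of the top component of the gate's value is a
monomial of the top component of an EFFECTIVE operand (nonzero coefficient), and the whole top
support of that operand lies in the top support of the gate (`topComponent_list_sum`: the top of
a positive combination is the positive combination of the tops of the effective operands of top
weighted degree). [folklore] -/
theorem exists_operand_of_mem_support_topComponent_sum {gs : List (Gate ℝ≥0 σ)} {j : ℕ}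
    {args : List (ℝ≥0 × Operand ℝ≥0 σ)} (hg : gs[j]? = some (Gate.sum args)) {m : σ →₀ ℕ}
    (hm : m ∈ (topComponent w (JerrumSnir.gateVal gs j)).support) :
    ∃ a ∈ args, a.1 ≠ 0 ∧ m ∈ (topComponent w (JerrumSnir.opVal gs j a.2)).support ∧
      (topComponent w (JerrumSnir.opVal gs j a.2)).support ⊆
        (topComponent w (JerrumSnir.gateVal gs j)).support := by
  set L : List (ℝ≥0 × MvPolynomial σ ℝ≥0) := args.map fun a => (a.1, JerrumSnir.opVal gs j a.2)
    with hL
  have hv : JerrumSnir.gateVal gs j = (L.map fun b => b.1 • b.2).sum := by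
    rw [JerrumSnir.gateVal_sum gs hg, hL, List.map_map]; rfl
  have htop := topComponent_list_sum w L
  rw [hv] at hm ⊢
  rw [htop] at hm
  obtain ⟨f, hf, hmf⟩ := JerrumSnir.mem_support_list_sum.1 hm
  obtain ⟨b, hb, rfl⟩ := List.mem_map.1 hf
  obtain ⟨hbL, hbP⟩ := List.mem_filter.1 hb
  simp only [decide_eq_true_eq] at hbP
  obtain ⟨a, ha, rfl⟩ := List.mem_map.1 hbL
  rw [JerrumSnir.support_smul_eq hbP.1] at hmf
  refine ⟨a, ha, hbP.1, hmf, fun x hx => ?_⟩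
  rw [htop, JerrumSnir.mem_support_list_sum]
  exact ⟨_, List.mem_map.2 ⟨_, hb, rfl⟩, by rwa [JerrumSnir.support_smul_eq hbP.1]⟩

omit [DecidableEq σ] in
/-- The operand semantics of the statement (`o.eval` against the values of the first `i` gates)
is `JerrumSnir.opVal`. [folklore] -/
theorem operand_eval_gateValues_take {gs : List (Gate ℝ≥0 σ)} {i : ℕ} (hi : i ≤ gs.length)
    (u : Operand ℝ≥0 σ) : u.eval (gateValues (gs.take i)) = JerrumSnir.opVal gs i u := by
  rw [JerrumSnir.gateValues_take gs hi, JerrumSnir.opVal_eq_eval]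

/-! ### The top-down walk -/

/-- **The walk (strong induction on the gate index).**  If the top component of the value of gate
`j` has two distinct monomials and every monomial `m` of it is live through the cofactor `b`
(`m + b ∈ T`), then some sum gate `i` (`≤ j`) has two effective operands whose tops are single
monomials `a₁ ≠ a₂` live through a common cofactor. [folklore] -/
theorem exists_liveTie_of_gateVal (gs : List (Gate ℝ≥0 σ)) (T : Finset (σ →₀ ℕ)) (j : ℕ) :
    ∀ (b m₁ m₂ : σ →₀ ℕ), m₁ ∈ (topComponent w (JerrumSnir.gateVal gs j)).support →
      m₂ ∈ (topComponent w (JerrumSnir.gateVal gs j)).support → m₁ ≠ m₂ →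
      (∀ m ∈ (topComponent w (JerrumSnir.gateVal gs j)).support, m + b ∈ T) →
      ∃ (i : ℕ) (args : List (ℝ≥0 × Operand ℝ≥0 σ)) (o₁ o₂ : ℝ≥0 × Operand ℝ≥0 σ)
        (a₁ a₂ b : σ →₀ ℕ),
        gs[i]? = some (Gate.sum args) ∧ o₁ ∈ args ∧ o₂ ∈ args ∧ o₁.1 ≠ 0 ∧ o₂.1 ≠ 0 ∧
        (topComponent w (o₁.2.eval (gateValues (gs.take i)))).support = {a₁} ∧
        (topComponent w (o₂.2.eval (gateValues (gs.take i)))).support = {a₂} ∧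
        a₁ ≠ a₂ ∧ a₁ + b ∈ T ∧ a₂ + b ∈ T := by
  induction j using Nat.strong_induction_on with
  | _ j ih =>
  intro b m₁ m₂ h₁ h₂ hne hlive
  rcases hg : gs[j]? with _ | ⟨args⟩ | ⟨us⟩
  · -- out of range: the value is the junk `0`
    rw [JerrumSnir.gateVal_of_none gs hg, topComponent_zero, support_zero] at h₁
    exact absurd h₁ (Finset.notMem_empty _)
  · -- SUM gate
    have hjl : j < gs.length := (List.getElem?_eq_some_iff.1 hg).1
    obtain ⟨o₁, ho₁, hc₁, hm₁, hsub₁⟩ :=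
      exists_operand_of_mem_support_topComponent_sum w hg h₁
    obtain ⟨o₂, ho₂, hc₂, hm₂, hsub₂⟩ :=
      exists_operand_of_mem_support_topComponent_sum w hg h₂
    -- either an effective operand has a non-monomial top (recurse into it) ...
    by_cases hS₁ : ∃ m ∈ (topComponent w (JerrumSnir.opVal gs j o₁.2)).support, m ≠ m₁
    · obtain ⟨m, hm, hmne⟩ := hS₁
      obtain ⟨j', hj', hval⟩ := exists_lt_opVal_eq_gateVal w hm hm₁ hmne
      rw [hval] at hm hm₁ hsub₁
      exact ih j' hj' b m m₁ hm hm₁ hmne fun x hx => hlive x (hsub₁ hx)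
    by_cases hS₂ : ∃ m ∈ (topComponent w (JerrumSnir.opVal gs j o₂.2)).support, m ≠ m₂
    · obtain ⟨m, hm, hmne⟩ := hS₂
      obtain ⟨j', hj', hval⟩ := exists_lt_opVal_eq_gateVal w hm hm₂ hmne
      rw [hval] at hm hm₂ hsub₂
      exact ih j' hj' b m m₂ hm hm₂ hmne fun x hx => hlive x (hsub₂ hx)
    -- ... or both tops are the single monomials `m₁ ≠ m₂`: the live tie is at gate `j`
    push Not at hS₁ hS₂
    refine ⟨j, args, o₁, o₂, m₁, m₂, b, hg, ho₁, ho₂, hc₁, hc₂, ?_, ?_, hne,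
      hlive m₁ (hsub₁ hm₁), hlive m₂ (hsub₂ hm₂)⟩
    · rw [operand_eval_gateValues_take hjl.le]
      exact Finset.eq_singleton_iff_unique_mem.2 ⟨hm₁, hS₁⟩
    · rw [operand_eval_gateValues_take hjl.le]
      exact Finset.eq_singleton_iff_unique_mem.2 ⟨hm₂, hS₂⟩
  · -- PRODUCT gate: some factor has a non-monomial top; recurse with the enlarged cofactor
    have hv : topComponent w (JerrumSnir.gateVal gs j) =
        (us.map fun u => topComponent w (JerrumSnir.opVal gs j u)).prod := by
      rw [JerrumSnir.gateVal_prod gs hg, topComponent_list_prod, List.map_map]; rfl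
    rw [hv] at h₁ h₂ hlive
    obtain ⟨p, hp, c, x₁, x₂, hx₁, hx₂, hxne, hall⟩ :=
      exists_factor_of_mem_support_prod _ h₁ h₂ hne
    obtain ⟨u, -, rfl⟩ := List.mem_map.1 hp
    obtain ⟨j', hj', hval⟩ := exists_lt_opVal_eq_gateVal w hx₁ hx₂ hxne
    simp only [hval] at hx₁ hx₂ hall
    refine ih j' hj' (c + b) x₁ x₂ hx₁ hx₂ hxne fun x hx => ?_
    rw [← add_assoc]
    exact hlive _ (hall x hx)

/-- **`stub_liveStructure` — the live structure lemma for monotone circuits over `ℝ≥0`.**  If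
the top-`w` component of the polynomial computed by a circuit `P` has two distinct monomials
`m₁ ≠ m₂` in its support, then some gate `i` of `P` is a weighted sum with two effective operands
`o₁, o₂` (nonzero coefficients) whose values — evaluated, as in the semantics of `gateValues`,
against the values of the first `i` gates — have top-`w` components supported on single
monomials `a₁ ≠ a₂`, and the pair is live: `a₁ + b` and `a₂ + b` are both monomials of the
top-`w` component of `P.eval` for one common exponent `b`.  (No well-formedness or fan-in
hypothesis: an out-of-range reference evaluates to `0`, whose top has empty support.)
[folklore] -/
theorem stub_liveStructure :
    ∀ (n : ℕ) (P : ArithCircuit ℝ≥0 (Fin n × Fin n)) (w : Fin n × Fin n → ℕ)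
      (m₁ m₂ : (Fin n × Fin n) →₀ ℕ),
      m₁ ∈ (topComponent w P.eval).support → m₂ ∈ (topComponent w P.eval).support → m₁ ≠ m₂ →
      ∃ (i : ℕ) (args : List (ℝ≥0 × ArithCircuit.Operand ℝ≥0 (Fin n × Fin n)))
        (o₁ o₂ : ℝ≥0 × ArithCircuit.Operand ℝ≥0 (Fin n × Fin n))
        (a₁ a₂ b : (Fin n × Fin n) →₀ ℕ),
        P.gates[i]? = some (ArithCircuit.Gate.sum args) ∧ o₁ ∈ args ∧ o₂ ∈ args ∧
        o₁.1 ≠ 0 ∧ o₂.1 ≠ 0 ∧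
        (topComponent w (o₁.2.eval (ArithCircuit.gateValues (P.gates.take i)))).support = {a₁} ∧
        (topComponent w (o₂.2.eval (ArithCircuit.gateValues (P.gates.take i)))).support = {a₂} ∧
        a₁ ≠ a₂ ∧
        a₁ + b ∈ (topComponent w P.eval).support ∧ a₂ + b ∈ (topComponent w P.eval).support := by
  intro n P w m₁ m₂ h₁ h₂ hne
  have hout := JerrumSnir.eval_eq_opVal P
  rw [hout] at h₁ h₂
  obtain ⟨j, -, hval⟩ := exists_lt_opVal_eq_gateVal w h₁ h₂ hne
  rw [hval] at h₁ h₂ hout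
  rw [hout]
  exact exists_liveTie_of_gateVal w P.gates _ j 0 m₁ m₂ h₁ h₂ hne fun m hm => by
    rwa [add_zero]

end Summit.ValiantsHypothesis.ValiantsHypothesis.Theorems.DivisionGapPerDivisionHard

end
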